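import Mathlib
import Literature.Geometry.Lorentzian.Basic
import Literature.Probability.LatticeModels.ONModelProofs
import Literature.Analysis.FunctionSpaces.ParametricIntegralSmooth

/-!
# Route StarvedNecks — crux `NecksCertify`, line `two-cap-focusing-ledger`: R1a-i helpers

Helper file for the stub `stub_sphereMeanDarboux` (Darboux's equation for spherical means on
`E3 = ℝ³`).  The classical identity `∫_{S²} Δ_{S²} g dσ = 0` is obtained without a divergence
theorem, from the rotation invariance of the sphere measure `σ = volume.toSphere`
(Evans, *PDE*, §2.4.1; Courant–Hilbert II, Ch. VI §13):

* `integral_comp_linearIsometryEquiv_toSphere`, `integral_comp_neg_toSphere` — `∫ F (R w) dσ =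
  ∫ F w dσ` for every linear isometry `R` of `E3` (tree: `map_rotate_toSphere`);
* `integral_fderiv_apply_skew_eq_zero` — for a skew `A : E3 →L[ℝ] E3` and `g ∈ C¹`,
  `∫ Dg(w)(Aw) dσ = 0`: `exp (tA)` is a one-parameter group of linear isometries
  (`NormedSpace.exp_mem_unitary_of_mem_skewAdjoint`), so `t ↦ ∫ g (exp (tA) w) dσ` is constant,
  and its derivative at `0` is computed under the integral sign (tree:
  `Literature.Analysis.FunctionSpaces.fderiv_parametric_integral_apply`);
* `integral_sndFDeriv_skew_eq_zero` — the same for `g = Dh(·)(A ·)`: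
  `∫ [D²h(w)(Aw, Aw) + Dh(w)(A²w)] dσ = 0`;
* `rot_sum_identity` — for the three infinitesimal rotations `L₁, L₂, L₃` of `ℝ³`,
  `∑ₖ [B(Lₖw, Lₖw) + ℓ(Lₖ²w)] = ‖w‖² tr B − B(w, w) − 2ℓ(w)` (pure algebra);
* `integral_laplacian_toSphere` — hence `∫_{S²} Δh dσ = ∫_{S²} [D²h(w)(w, w) + 2 Dh(w)(w)] dσ`
  for `h ∈ C²(E3)`.

Mathlib + `Literature.Probability.LatticeModels.ONModelProofs` (rotation invariance of
`toSphere`) + `Literature.Analysis.FunctionSpaces.ParametricIntegralSmooth`; no named facts.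
-/

noncomputable section

open scoped Manifold ContDiff Topology ENNReal RealInnerProductSpace
open Filter Set MeasureTheory Topology Literature.Geometry.Lorentzian NormedSpace

namespace Summit.FinalStateConjecture.FinalStateConjecture.Theorems.NecksCertifyTwoCap.Darboux

/-- **Rotation invariance of sphere integrals.** For every linear isometry `R` of `E3` and every
`F : E3 → G`, `∫_{S²} F (R w) dσ(w) = ∫_{S²} F w dσ(w)`, `σ = volume.toSphere` (the cone measure
is `O(3)`-invariant because Lebesgue measure is; tree: `map_rotate_toSphere`). [folklore] -/
theorem integral_comp_linearIsometryEquiv_toSphere {G : Type*} [NormedAddCommGroup G]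
    [NormedSpace ℝ G] (R : E3 ≃ₗᵢ[ℝ] E3) (F : E3 → G) :
    ∫ w : Metric.sphere (0 : E3) 1, F (R (w : E3)) ∂((volume : Measure E3).toSphere) =
      ∫ w : Metric.sphere (0 : E3) 1, F (w : E3) ∂((volume : Measure E3).toSphere) := by
  have hmem : ∀ (T : E3 ≃ₗᵢ[ℝ] E3) (v : Metric.sphere (0 : E3) 1),
      T v ∈ Metric.sphere (0 : E3) 1 := fun T v ↦ by simp [T.norm_map]
  let e : Metric.sphere (0 : E3) 1 ≃ᵐ Metric.sphere (0 : E3) 1 :=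
    { toFun := fun v ↦ ⟨R v, hmem R v⟩
      invFun := fun v ↦ ⟨R.symm v, hmem R.symm v⟩
      left_inv := fun v ↦ Subtype.ext (R.symm_apply_apply v)
      right_inv := fun v ↦ Subtype.ext (R.apply_symm_apply v)
      measurable_toFun := (R.continuous.measurable.comp measurable_subtype_coe).subtype_mk
      measurable_invFun := (R.symm.continuous.measurable.comp measurable_subtype_coe).subtype_mk }
  have hmp : MeasurePreserving e (volume : Measure E3).toSphere (volume : Measure E3).toSphere :=
    ⟨e.measurable, Literature.Probability.LatticeModels.map_rotate_toSphere R⟩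
  exact hmp.integral_comp' (fun v : Metric.sphere (0 : E3) 1 ↦ F v)

/-- **Antipodal symmetry**: `∫_{S²} F (-w) dσ = ∫_{S²} F w dσ`. [folklore] -/
theorem integral_comp_neg_toSphere {G : Type*} [NormedAddCommGroup G] [NormedSpace ℝ G]
    (F : E3 → G) :
    ∫ w : Metric.sphere (0 : E3) 1, F (-(w : E3)) ∂((volume : Measure E3).toSphere) =
      ∫ w : Metric.sphere (0 : E3) 1, F (w : E3) ∂((volume : Measure E3).toSphere) :=
  integral_comp_linearIsometryEquiv_toSphere (LinearIsometryEquiv.neg ℝ) F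

/-- Continuous integrands are integrable against the (finite) sphere measure on the (compact)
unit sphere. [folklore] -/
theorem integrable_toSphere_of_continuous {G : Type*} [NormedAddCommGroup G]
    {F : Metric.sphere (0 : E3) 1 → G} (hF : Continuous F) :
    Integrable F ((volume : Measure E3).toSphere) := by
  obtain ⟨C, hC⟩ := isCompact_univ.exists_bound_of_continuousOn hF.continuousOn
  exact Integrable.mono' (integrable_const C) hF.aestronglyMeasurable
    (ae_of_all _ fun w ↦ hC w (mem_univ w))

/-- **Angular derivatives integrate to zero.** If `A : E3 →L[ℝ] E3` is skew
(`⟪A u, v⟫ = -⟪u, A v⟫`) and `g` is `C¹`, then `∫_{S²} Dg(w)(A w) dσ(w) = 0`: the rotations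
`exp (t A)` are linear isometries, so `t ↦ ∫ g (exp (tA) w) dσ` is constant by rotation
invariance of `σ`, and its derivative at `t = 0`, computed under the integral sign, is the
displayed integral. [folklore] -/
theorem integral_fderiv_apply_skew_eq_zero (A : E3 →L[ℝ] E3)
    (hA : ∀ u v : E3, ⟪A u, v⟫ = -⟪u, A v⟫) {g : E3 → ℝ} (hg : ContDiff ℝ 1 g) :
    ∫ w : Metric.sphere (0 : E3) 1, fderiv ℝ g w (A w) ∂((volume : Measure E3).toSphere) = 0 := by
  letI : NormedAlgebra ℚ (E3 →L[ℝ] E3) := NormedAlgebra.restrictScalars ℚ ℝ (E3 →L[ℝ] E3)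
  -- `A` is skew-adjoint, so `exp (t • A)` is unitary
  have hstar : star A = -A := by
    rw [ContinuousLinearMap.star_eq_adjoint]
    refine ContinuousLinearMap.ext fun u ↦ ext_inner_right ℝ fun v ↦ ?_
    rw [ContinuousLinearMap.adjoint_inner_left, neg_apply, inner_neg_left,
      hA u v, neg_neg]
  have hU : ∀ t : ℝ, exp (t • A) ∈ unitary (E3 →L[ℝ] E3) := fun t ↦
    exp_mem_unitary_of_mem_skewAdjoint (by
      rw [skewAdjoint.mem_iff, star_smul, hstar, star_trivial, smul_neg])
  have hRapply : ∀ (t : ℝ) (y : E3),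
      (Unitary.linearIsometryEquiv ⟨exp (t • A), hU t⟩ : E3 ≃ₗᵢ[ℝ] E3) y = exp (t • A) y :=
    fun t y ↦ rfl
  -- the jointly `C¹` integrand `(y, t) ↦ g (exp (tA) y)`
  have hexp : ContDiff ℝ 1 (fun T : E3 →L[ℝ] E3 ↦ exp T) :=
    contDiff_iff_contDiffAt.2 fun T ↦ (NormedSpace.exp_analytic (𝕂 := ℝ) T).contDiffAt
  have hGs : ContDiff ℝ 1 (fun q : E3 × ℝ ↦ g (exp (q.2 • A) q.1)) :=
    hg.comp ((hexp.comp (contDiff_snd.smul contDiff_const)).clm_apply contDiff_fst)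
  -- the parametric integral is constant in `t`
  have hconst : (fun t : ℝ ↦ ∫ w : Metric.sphere (0 : E3) 1,
      (fun q : E3 × ℝ ↦ g (exp (q.2 • A) q.1)) ((w : E3), t) ∂((volume : Measure E3).toSphere)) =
      fun _ ↦ ∫ w : Metric.sphere (0 : E3) 1, g w ∂((volume : Measure E3).toSphere) := by
    funext t
    have h := integral_comp_linearIsometryEquiv_toSphere
      (Unitary.linearIsometryEquiv ⟨exp (t • A), hU t⟩) g
    simpa only [hRapply] using h
  have h1 : (1 : WithTop ℕ∞) ≠ 0 := one_ne_zero
  have hderiv := Literature.Analysis.FunctionSpaces.fderiv_parametric_integral_apply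
    (μ := (volume : Measure E3).toSphere) (ι := (Subtype.val : Metric.sphere (0 : E3) 1 → E3))
    measurable_subtype_coe (isCompact_sphere (0 : E3) 1) (ae_of_all _ fun w ↦ w.2) hGs h1 0 1
  rw [hconst, fderiv_const_apply, zero_apply] at hderiv
  -- pointwise identification of the `t`-derivative at `t = 0`
  have hpt : ∀ y : E3, fderiv ℝ (fun q : E3 × ℝ ↦ g (exp (q.2 • A) q.1)) (y, 0) ((0 : E3), (1 : ℝ))
      = fderiv ℝ g y (A y) := by
    intro y
    have hd1 : HasDerivAt (fun s : ℝ ↦ (fun q : E3 × ℝ ↦ g (exp (q.2 • A) q.1)) (y, s))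
        (fderiv ℝ (fun q : E3 × ℝ ↦ g (exp (q.2 • A) q.1)) (y, 0) ((0 : E3), (1 : ℝ))) 0 :=
      ((hGs.differentiable h1) (y, 0)).hasFDerivAt.comp_hasDerivAt (0 : ℝ)
        ((hasDerivAt_const (0 : ℝ) y).prodMk (hasDerivAt_id (0 : ℝ)))
    -- (the `WithLp` module-instance diamond on `E3 →L[ℝ] E3` blocks `simp`; rewrite by hand)
    have hz : (0 : ℝ) • A = 0 := zero_smul ℝ A
    have hey : HasDerivAt (fun s : ℝ ↦ exp (s • A) y) (A y) 0 := by
      have h := (ContinuousLinearMap.apply ℝ E3 y).hasFDerivAt.comp_hasDerivAt (0 : ℝ)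
        (hasDerivAt_exp_smul_const' (𝕂 := ℝ) A 0)
      have h0 : (ContinuousLinearMap.apply ℝ E3 y) (A * exp ((0 : ℝ) • A)) = A y := by
        rw [hz, exp_zero, mul_one]
        rfl
      exact h.congr_deriv h0
    have hl : HasFDerivAt g (fderiv ℝ g y) ((fun s : ℝ ↦ exp (s • A) y) 0) := by
      have hy0 : (fun s : ℝ ↦ exp (s • A) y) 0 = y := by
        show exp ((0 : ℝ) • A) y = y
        rw [hz, exp_zero]
        rfl
      rw [hy0]
      exact ((hg.differentiable h1) y).hasFDerivAt
    have hd2 : HasDerivAt (fun s : ℝ ↦ (fun q : E3 × ℝ ↦ g (exp (q.2 • A) q.1)) (y, s))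
        (fderiv ℝ g y (A y)) 0 := hl.comp_hasDerivAt (0 : ℝ) hey
    exact hd1.unique hd2
  have hfun : (fun w : Metric.sphere (0 : E3) 1 ↦ fderiv ℝ g w (A w)) =
      fun w : Metric.sphere (0 : E3) 1 ↦
        fderiv ℝ (fun q : E3 × ℝ ↦ g (exp (q.2 • A) q.1)) ((w : E3), 0) ((0 : E3), (1 : ℝ)) :=
    funext fun w ↦ (hpt w).symm
  rw [hfun]
  exact hderiv.symm


/-- **Second-order form of the angular identity.** For `h ∈ C²` and a skew `A`,
`∫_{S²} [D²h(w)(Aw, Aw) + Dh(w)(A²w)] dσ = 0` (apply `integral_fderiv_apply_skew_eq_zero` to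
`w ↦ Dh(w)(Aw)`). [folklore] -/
theorem integral_sndFDeriv_skew_eq_zero (A : E3 →L[ℝ] E3)
    (hA : ∀ u v : E3, ⟪A u, v⟫ = -⟪u, A v⟫) {h : E3 → ℝ} (hh : ContDiff ℝ 2 h) :
    ∫ w : Metric.sphere (0 : E3) 1,
      (fderiv ℝ (fderiv ℝ h) w (A w) (A w) + fderiv ℝ h w (A (A w)))
        ∂((volume : Measure E3).toSphere) = 0 := by
  have h12 : (1 : WithTop ℕ∞) + 1 ≤ 2 := by norm_num
  have hDh : ContDiff ℝ 1 (fderiv ℝ h) := hh.fderiv_right h12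
  have hg : ContDiff ℝ 1 (fun y : E3 ↦ fderiv ℝ h y (A y)) := hDh.clm_apply A.contDiff
  have h0 := integral_fderiv_apply_skew_eq_zero A hA hg
  have hpt : ∀ w : E3, fderiv ℝ (fderiv ℝ h) w (A w) (A w) + fderiv ℝ h w (A (A w)) =
      fderiv ℝ (fun y : E3 ↦ fderiv ℝ h y (A y)) w (A w) := by
    intro w
    rw [fderiv_clm_apply ((hDh.differentiable one_ne_zero) w) A.differentiableAt,
      ContinuousLinearMap.fderiv, add_apply, ContinuousLinearMap.comp_apply,
      ContinuousLinearMap.flip_apply, add_comm]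
  have hfun : (fun w : Metric.sphere (0 : E3) 1 ↦
      fderiv ℝ (fderiv ℝ h) w (A w) (A w) + fderiv ℝ h w (A (A w))) =
      fun w : Metric.sphere (0 : E3) 1 ↦ fderiv ℝ (fun y : E3 ↦ fderiv ℝ h y (A y)) w (A w) :=
    funext fun w ↦ hpt w
  rw [hfun]
  exact h0

/-! ### The three infinitesimal rotations and the trace identity -/

/-- The infinitesimal rotations `L i j : w ↦ wᵢ eⱼ - wⱼ eᵢ` (any family of continuous linear maps
with these values) are skew: `⟪L i j u, v⟫ = -⟪u, L i j v⟫`. [folklore] -/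
theorem rot_skew (L : Fin 3 → Fin 3 → (E3 →L[ℝ] E3))
    (hL : ∀ (i j : Fin 3) (w : E3), L i j w =
      w i • (EuclideanSpace.single j (1 : ℝ) : E3) - w j • (EuclideanSpace.single i (1 : ℝ) : E3))
    (i j : Fin 3) (u v : E3) : ⟪L i j u, v⟫ = -⟪u, L i j v⟫ := by
  rw [hL, hL, inner_sub_left, inner_sub_right, real_inner_smul_left,
    real_inner_smul_left, real_inner_smul_right, real_inner_smul_right,
    EuclideanSpace.inner_single_left, EuclideanSpace.inner_single_left,
    EuclideanSpace.inner_single_right, EuclideanSpace.inner_single_right]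
  simp only [map_one, one_mul, conj_trivial]
  ring

/-- Existence of the family of infinitesimal rotations as continuous linear maps:
`L i j = ⟪eᵢ, ·⟫ eⱼ - ⟪eⱼ, ·⟫ eᵢ`. [folklore] -/
theorem exists_rot : ∃ L : Fin 3 → Fin 3 → (E3 →L[ℝ] E3), ∀ (i j : Fin 3) (w : E3), L i j w =
      w i • (EuclideanSpace.single j (1 : ℝ) : E3) - w j • (EuclideanSpace.single i (1 : ℝ) : E3) :=
  ⟨fun i j ↦ ContinuousLinearMap.smulRight (innerSL ℝ (EuclideanSpace.single i (1 : ℝ) : E3))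
      (EuclideanSpace.single j (1 : ℝ) : E3) -
    ContinuousLinearMap.smulRight (innerSL ℝ (EuclideanSpace.single j (1 : ℝ) : E3))
      (EuclideanSpace.single i (1 : ℝ) : E3),
    fun i j w ↦ by simp [EuclideanSpace.inner_single_left]⟩

/-- **The trace identity** `∑_{planes} [B(Lw, Lw) + ℓ(L(Lw))] = ‖w‖² tr B - B(w, w) - 2 ℓ(w)` for a
bilinear `B`, a linear `ℓ` and the three infinitesimal rotations `L 1 2, L 2 0, L 0 1`
(expand in coordinates). [folklore] -/
theorem rot_sum_identity (L : Fin 3 → Fin 3 → (E3 →L[ℝ] E3))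
    (hL : ∀ (i j : Fin 3) (w : E3), L i j w =
      w i • (EuclideanSpace.single j (1 : ℝ) : E3) - w j • (EuclideanSpace.single i (1 : ℝ) : E3))
    (B : E3 →L[ℝ] E3 →L[ℝ] ℝ) (ℓ : E3 →L[ℝ] ℝ) (w : E3) :
    (B (L 1 2 w) (L 1 2 w) + ℓ (L 1 2 (L 1 2 w))) +
    (B (L 2 0 w) (L 2 0 w) + ℓ (L 2 0 (L 2 0 w))) +
    (B (L 0 1 w) (L 0 1 w) + ℓ (L 0 1 (L 0 1 w))) =
      ‖w‖ ^ 2 * (∑ i : Fin 3, B (EuclideanSpace.single i (1 : ℝ)) (EuclideanSpace.single i (1 : ℝ)))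
        - B w w - 2 * ℓ w := by
  obtain ⟨a, b, c, rfl⟩ : ∃ a b c : ℝ, w = a • (EuclideanSpace.single 0 (1 : ℝ) : E3) +
      b • (EuclideanSpace.single 1 (1 : ℝ) : E3) + c • (EuclideanSpace.single 2 (1 : ℝ) : E3) :=
    ⟨w 0, w 1, w 2, by
      simpa [Fin.sum_univ_three] using ((EuclideanSpace.basisFun (Fin 3) ℝ).sum_repr w).symm⟩
  have hn : ‖a • (EuclideanSpace.single 0 (1 : ℝ) : E3) + b • (EuclideanSpace.single 1 (1 : ℝ) : E3)
      + c • (EuclideanSpace.single 2 (1 : ℝ) : E3)‖ ^ 2 = a ^ 2 + b ^ 2 + c ^ 2 := by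
    rw [EuclideanSpace.real_norm_sq_eq, Fin.sum_univ_three]
    simp
  simp only [hL]
  rw [hn, Fin.sum_univ_three]
  simp only [map_add, map_sub, map_smul, FunLike.coe_add, FunLike.coe_sub, FunLike.coe_smul,
    Pi.add_apply, Pi.sub_apply, Pi.smul_apply, smul_eq_mul, PiLp.add_apply, PiLp.sub_apply,
    PiLp.smul_apply, PiLp.single_apply, Fin.reduceEq, ite_true, ite_false, mul_one, mul_zero]
  ring

/-- **The spherical Laplacian integrates to zero** (in Euclidean terms): for `h ∈ C²(E3)`,
`∫_{S²} Δh(w) dσ = ∫_{S²} [D²h(w)(w, w) + 2 Dh(w)(w)] dσ`, i.e. `∫_{S²} Δ_{S²} (h|_{S²}) dσ = 0`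
(sum of the three second-order angular identities and the trace identity on `‖w‖ = 1`).
[folklore] -/
theorem integral_laplacian_toSphere {h : E3 → ℝ} (hh : ContDiff ℝ 2 h) :
    ∫ w : Metric.sphere (0 : E3) 1,
      (∑ i : Fin 3, fderiv ℝ (fderiv ℝ h) w (EuclideanSpace.single i (1 : ℝ))
        (EuclideanSpace.single i (1 : ℝ))) ∂((volume : Measure E3).toSphere) =
    ∫ w : Metric.sphere (0 : E3) 1,
      (fderiv ℝ (fderiv ℝ h) w w w + 2 * fderiv ℝ h w w) ∂((volume : Measure E3).toSphere) := by
  obtain ⟨L, hL⟩ := exists_rot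
  have h1 := integral_sndFDeriv_skew_eq_zero (L 1 2) (rot_skew L hL 1 2) hh
  have h2 := integral_sndFDeriv_skew_eq_zero (L 2 0) (rot_skew L hL 2 0) hh
  have h3 := integral_sndFDeriv_skew_eq_zero (L 0 1) (rot_skew L hL 0 1) hh
  have h12 : (1 : WithTop ℕ∞) + 1 ≤ 2 := by norm_num
  have hc1 : Continuous (fderiv ℝ h) := hh.continuous_fderiv two_ne_zero
  have hc2 : Continuous (fderiv ℝ (fderiv ℝ h)) :=
    (hh.fderiv_right h12).continuous_fderiv one_ne_zero
  have hint : ∀ A : E3 →L[ℝ] E3, Integrable (fun w : Metric.sphere (0 : E3) 1 ↦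
      fderiv ℝ (fderiv ℝ h) w (A w) (A w) + fderiv ℝ h w (A (A w)))
      ((volume : Measure E3).toSphere) :=
    fun A ↦ integrable_toSphere_of_continuous (by fun_prop)
  have hintR : Integrable (fun w : Metric.sphere (0 : E3) 1 ↦
      fderiv ℝ (fderiv ℝ h) w w w + 2 * fderiv ℝ h w w) ((volume : Measure E3).toSphere) :=
    integrable_toSphere_of_continuous (by fun_prop)
  have hpt : ∀ w : Metric.sphere (0 : E3) 1,
      (∑ i : Fin 3, fderiv ℝ (fderiv ℝ h) w (EuclideanSpace.single i (1 : ℝ))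
        (EuclideanSpace.single i (1 : ℝ))) =
      ((fderiv ℝ (fderiv ℝ h) w (L 1 2 w) (L 1 2 w) + fderiv ℝ h w (L 1 2 (L 1 2 w))) +
       (fderiv ℝ (fderiv ℝ h) w (L 2 0 w) (L 2 0 w) + fderiv ℝ h w (L 2 0 (L 2 0 w))) +
       (fderiv ℝ (fderiv ℝ h) w (L 0 1 w) (L 0 1 w) + fderiv ℝ h w (L 0 1 (L 0 1 w)))) +
      (fderiv ℝ (fderiv ℝ h) w w w + 2 * fderiv ℝ h w w) := by
    intro w
    have hw : ‖(w : E3)‖ = 1 := by simp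
    have := rot_sum_identity L hL (fderiv ℝ (fderiv ℝ h) w) (fderiv ℝ h w) w
    rw [hw, one_pow, one_mul] at this
    linarith
  rw [integral_congr_ae (ae_of_all _ hpt), integral_add _ hintR, integral_add _ (hint _),
    integral_add (hint _) (hint _), h1, h2, h3]
  · ring
  · exact (hint _).add (hint _)
  · exact ((hint _).add (hint _)).add (hint _)

/-- **Registered helper stub** `stub_sphereMeanDarboux_laplacianSphere` (verbatim): for
`h ∈ C²(E3)`, `∫_{S²} Δh dσ = ∫_{S²} [D²h(w)(w, w) + 2 Dh(w)(w)] dσ` (`integral_laplacian_toSphere`).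
[folklore] -/
theorem stub_sphereMeanDarboux_laplacianSphere :
    ∀ (h : E3 → ℝ), ContDiff ℝ 2 h → ∫ (w : Metric.sphere (0 : E3) 1), (∑ i : Fin 3, fderiv ℝ (fderiv ℝ h) (w : E3) (EuclideanSpace.single i (1 : ℝ)) (EuclideanSpace.single i (1 : ℝ))) ∂((volume : Measure E3).toSphere) = ∫ (w : Metric.sphere (0 : E3) 1), (fderiv ℝ (fderiv ℝ h) (w : E3) (w : E3) (w : E3) + 2 * fderiv ℝ h (w : E3) (w : E3)) ∂((volume : Measure E3).toSphere) :=
  fun _ hh ↦ integral_laplacian_toSphere hh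

end Summit.FinalStateConjecture.FinalStateConjecture.Theorems.NecksCertifyTwoCap.Darboux

end
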